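import Mathlib.RingTheory.PowerSeries.Order
import Literature.NumberTheory.EllipticCurves.PAdicLFunctionK
import Literature.NumberTheory.EllipticCurves.CanonicalPAdicHeight
import Literature.NumberTheory.EllipticCurves.HeegnerPoints
import HarnessLib

/-!
# Named fact: the `p`-adic Gross–Zagier formula of Perrin-Riou (good ordinary `p`, split in `K`)

Trunk T-NT-EC (Literature/NumberTheory/EllipticCurves); fact item `wi-03670` for the route
BirchSwinnertonDyer/PAdicOrder (crux #2 / stmt-BirchSwinnertonDyer-0515, analytic rank one).

**Source.** B. Perrin-Riou, *Points de Heegner et dérivées de fonctions `L` `p`-adiques*,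
Invent. Math. 89 (1987) 455–510, §1: hypotheses (H1) `p ∤ N`, (H2) `f` ordinary at `p`,
(H3) `(N, D) = 1`, (H4) every prime dividing `N` splits in `k`; §1.4 adds: every prime dividing
`Np` splits in `k`, `D` odd (and `p` odd, Introduction). **Théorème 1.3** (§1.4, p. 461): the
`p`-adic `L`-function `L_p(f, ψ)` of `f` over `k` (Thm. 1.1, a two-variable Iwasawa function on
the `ℤ_p²`-extension of `k`) vanishes at the trivial character and its derivative there in the
direction of a continuous character `ρ` of `G(k_∞/k)` equals an explicit non-zero constant times
the `p`-adic height `⟨y_{ψ,f}, y_{ψ̄,f}⟩_{ρ_H}` of the Heegner divisor class; p. 463 restates it for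
a modular elliptic curve `E = X₀(N) ↠ E` with `L_p(E, ψ) := L_p(f, ψ)` and the canonical
Schneider–Mazur–Tate `p`-adic height `⟨ , ⟩_{ρ_H,E}` on `E`; formula (1.1) (p. 459) factors the
restriction of `L_p(f, ψ₀)` to the cyclotomic line as `L_p(f) · L_p(f^{(ε)})` (Mazur–Swinnerton-Dyer
functions of `f` and of its twist by the quadratic character `ε` of `k`) times a non-vanishing
factor. (Thm. 1.1 of the item's citation is the EXISTENCE of `L_p(f, ψ)`; the formula is Thm. 1.3;
Cor. 1.8 is the consequence for `L_p(E/ℚ)`.)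

**What is vendored (faithfulness note).** The tree has neither Perrin-Riou's Rankin-type
`L_p(f, ψ)` nor her height: it has the SHORTCUT `Literature.padicLFunctionEK W p K hf hg =
L_p(f, α, T) · L_p(g, χ_K(p) α, T)` (`PAdicLFunctionK.lean`; equal to the cyclotomic restriction of
`L_p(f, ψ₀)` up to a non-vanishing factor by PR87 (1.1), in the variable `T = ν(γ)^s - 1`, so
`d/ds = log_p ν(γ) · (1+T) d/dT` with `log_p ν(γ) ≠ 0`), and the canonicity PREDICATE
`WeierstrassCurve.PAdicHeightDataK.IsCanonical DK` (`CanonicalPAdicHeight.lean`; the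
Mazur–Stein–Tate / Balakrishnan–Çiperiani–Stein sigma-function normalisation, `= -2p ×` the
Mazur–Tate = Schneider canonical height summed over the places of `K`; Mazur–Stein–Tate 2006, §1
and Thm. 1.3; Balakrishnan–Çiperiani–Stein 2015, §4.1 (4.1)). Every normalisation therefore enters
only through NON-ZERO constants (Perrin-Riou's constant contains `(1 - α⁻¹)⁴ ≠ 0` as `|α| = √p`,
periods, `u`, `h`, `√|D|`, the constant `c_π` of the parametrisation), and the statement recorded
here is exactly the normalisation-free content of Thm. 1.3 for the tree's objects:

  `L_p(E/K, T)` has zero constant term, and its `T`-coefficient vanishes iff the canonical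
  cyclotomic `p`-adic height `⟨P_K, P_K⟩` of the Heegner point `P_K ∈ E(K)` vanishes.

This is implied by (never stronger than) the source; the explicit constant is deliberately not
transcribed. Hypotheses are those of PR87 §1.4 in tree terms, with `p ≥ 5` (PR: `p` odd) because
the tree's sigma-function height is set up for `p ≥ 5` (all facts of `CanonicalPAdicHeight.lean`
carry `5 ≤ p`). The level is pinned to the conductor (`W.conductorNorm ℤ = N`, as in
`BSDHeegnerPoints.lean`); modularity `X₀(N) ↠ E` is inside `IsHeegnerPoint` (a
`ModularParametrizationData`). Nothing is asserted: users take `(h : perrinRiou_padicGrossZagier)`;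
non-vacuity of the `∀ DK, DK.IsCanonical → …` clause is the separate fact
`WeierstrassCurve.exists_isCanonicalK`.

* `Literature.NumberTheory.EllipticCurves.perrinRiou_padicGrossZagier` — the named fact.
* `Literature.NumberTheory.EllipticCurves.perrinRiou_padicGrossZagier.one_le_order`, `.order_eq_one_iff` — PROVED corollaries in the
  `PowerSeries.order` form used by the route (`ord_{T=0} L_p(E/K, T) ≥ 1`, and `= 1 ↔ ⟨P_K,P_K⟩ ≠ 0`).
* `Literature.NumberTheory.EllipticCurves.perrinRiou_rankOne_leadingTerms` — the consequence over
  `ℚ` in analytic rank one WITH the exact constant (Perrin-Riou 1987, §1.4, Cor. 1.8; restated in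
  the present normalisations by Stein–Wuthrich 2013, §9): `L'(E,1) = c·Ω⁺_f·ĥ(P)` and
  `[T¹]L_p(f,α,T)·log_p γ = c·(1 - α⁻¹)²·⟨P,P⟩_p` for one rational `c` and one non-torsion
  `P ∈ E(ℚ)` (named fact; appended 2026-08-16 for route BirchSwinnertonDyer/LeadingTerm, item
  stmt-BirchSwinnertonDyer-16219 `RankLeOne`).

## References

* B. Perrin-Riou, Invent. Math. 89 (1987), §1.1 (Thm. 1.1, (1.1)), §1.3 (Thm. 1.2), §1.4
  (Thm. 1.3, Cor. 1.6–1.9).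
* D. Disegni, *The `p`-adic Gross–Zagier formula on Shimura curves, II*, (1.1.1) and §1.1
  ("originally proved by Perrin-Riou for `p`-ordinary elliptic curves over `ℚ`, under the
  assumption that `p` splits"; formula stated "up to a non-zero factor").
* B. Mazur, W. Stein, J. Tate, Doc. Math. Extra Vol. (2006), §1, Thm. 1.3; J. Balakrishnan,
  M. Çiperiani, W. Stein, Math. Comp. 84 (2015), §4.1 (4.1) (height normalisations).
-/

noncomputable section

open scoped MatrixGroups ModularForm
open CongruenceSubgroup NumberField Literature.NumberTheory.EllipticCurves.ModularForms

namespace Literature.NumberTheory.EllipticCurves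

/-- **Perrin-Riou's `p`-adic Gross–Zagier formula, normalisation-free form** (Perrin-Riou 1987,
Thm. 1.3 with its elliptic-curve restatement, §1.4 p. 463, and the factorisation (1.1)). Let
`E/ℚ` be an elliptic curve with globally minimal model `W` and conductor `N`, `f` its newform and
`g` the newform of the quadratic twist `E^{(d_K)}`; let `p ≥ 5` be a prime of good ORDINARY
reduction; let `K` be an imaginary quadratic field with ODD discriminant `d_K` coprime to `N`, such
that every prime dividing `N` splits in `K` (Heegner hypothesis) and `p` splits in `K`. Then for
THE canonical cyclotomic `p`-adic height datum `DK` on `E(K)` and every Heegner point `P_K ∈ E(K)`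
of level `N`: the cyclotomic `p`-adic `L`-function `L_p(E/K, T)` (`padicLFunctionEK`, `= L_p(E,T)
L_p(E^{(d_K)},T)`) has constant term `0`, and its linear coefficient vanishes iff
`⟨P_K, P_K⟩_{p,K} = 0`. (Source form: `L_p(f,ψ₀)(𝟙) = 0` and
`(d/ds) L_p(f,ψ₀)(ν^s)|_{s=0} = C · ⟨y_K, ȳ_K⟩_p` with `C ≠ 0` explicit; all normalisation
constants relating the tree's objects to Perrin-Riou's are non-zero, see the module docstring.)
[cite: PerrinRiou1987, Thm. 1.3 (§1.4) and (1.1)] -/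
def perrinRiou_padicGrossZagier : Prop :=
  ∀ (W : WeierstrassCurve ℚ) [W.IsElliptic] [W.IsGloballyMinimal] (p : ℕ) [Fact p.Prime]
    (K : Type) [Field K] [NumberField K] (N : ℕ) [NeZero N]
    {Nf Ng : ℕ} [NeZero Nf] [NeZero Ng] {f : CuspForm (Gamma0 Nf) 2} {g : CuspForm (Gamma0 Ng) 2}
    (hf : IsNewformOf W f) (hg : IsNewformOf (W.quadraticTwist (NumberField.discr K : ℚ)) g),
    5 ≤ p → W.HasGoodReductionAtPrime p → ¬ (p : ℤ) ∣ W.frobeniusTrace p →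
    IsImaginaryQuadratic K → Odd (NumberField.discr K) →
    IsCoprime (NumberField.discr K) (N : ℤ) → W.conductorNorm ℤ = N →
    SatisfiesHeegnerHypothesis N K → ((Ideal.span {(p : ℤ)}).primesOver (𝓞 K)).ncard = 2 →
    ∀ (DK : WeierstrassCurve.PAdicHeightDataK W p K), DK.IsCanonical →
    ∀ (P : (W.baseChange K).toAffine.Point), IsHeegnerPoint N W K P →
      PowerSeries.constantCoeff (padicLFunctionEK W p K hf hg) = 0 ∧
        (PowerSeries.coeff 1 (padicLFunctionEK W p K hf hg) = 0 ↔ DK.height P = 0)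

namespace perrinRiou_padicGrossZagier

variable (h : perrinRiou_padicGrossZagier)
  {W : WeierstrassCurve ℚ} [W.IsElliptic] [W.IsGloballyMinimal] {p : ℕ} [Fact p.Prime]
  {K : Type} [Field K] [NumberField K] {N : ℕ} [NeZero N]
  {Nf Ng : ℕ} [NeZero Nf] [NeZero Ng] {f : CuspForm (Gamma0 Nf) 2} {g : CuspForm (Gamma0 Ng) 2}
  (hf : IsNewformOf W f) (hg : IsNewformOf (W.quadraticTwist (NumberField.discr K : ℚ)) g)
  (hp : 5 ≤ p) (hgood : W.HasGoodReductionAtPrime p) (hord : ¬ (p : ℤ) ∣ W.frobeniusTrace p)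
  (hK : IsImaginaryQuadratic K) (hodd : Odd (NumberField.discr K))
  (hcop : IsCoprime (NumberField.discr K) (N : ℤ)) (hN : W.conductorNorm ℤ = N)
  (hH : SatisfiesHeegnerHypothesis N K)
  (hsplit : ((Ideal.span {(p : ℤ)}).primesOver (𝓞 K)).ncard = 2)
  {DK : WeierstrassCurve.PAdicHeightDataK W p K} (hDK : DK.IsCanonical)
  {P : (W.baseChange K).toAffine.Point} (hP : IsHeegnerPoint N W K P)

include h hp hgood hord hK hodd hcop hN hH hsplit hDK hP

/-- Under the hypotheses of the `p`-adic Gross–Zagier formula, `L_p(E/K, T)` vanishes at `T = 0`: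
`ord_{T=0} L_p(E/K, T) ≥ 1` (Perrin-Riou 1987, Thm. 1.3, first clause). [cite: PerrinRiou1987, Thm. 1.3] -/
theorem one_le_order : (1 : ℕ∞) ≤ (padicLFunctionEK W p K hf hg).order := by
  have h0 := (h W p K N hf hg hp hgood hord hK hodd hcop hN hH hsplit DK hDK P hP).1
  refine PowerSeries.nat_le_order _ 1 fun i hi ↦ ?_
  obtain rfl : i = 0 := by omega
  rwa [PowerSeries.coeff_zero_eq_constantCoeff_apply]

/-- Under the hypotheses of the `p`-adic Gross–Zagier formula, `L_p(E/K, T)` has a SIMPLE zero at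
`T = 0` iff the canonical cyclotomic `p`-adic height of the Heegner point is non-zero
(Perrin-Riou 1987, Thm. 1.3; cf. Cor. 1.6–1.8). [cite: PerrinRiou1987, Thm. 1.3] -/
theorem order_eq_one_iff : (padicLFunctionEK W p K hf hg).order = 1 ↔ DK.height P ≠ 0 := by
  obtain ⟨h0, h1⟩ := h W p K N hf hg hp hgood hord hK hodd hcop hN hH hsplit DK hDK P hP
  have h1' : PowerSeries.coeff 1 (padicLFunctionEK W p K hf hg) ≠ 0 ↔ DK.height P ≠ 0 :=
    not_congr h1
  rw [← h1', show (1 : ℕ∞) = ((1 : ℕ) : ℕ∞) from rfl, PowerSeries.order_eq_nat]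
  constructor
  · exact fun hh ↦ hh.1
  · intro hh
    refine ⟨hh, fun i hi ↦ ?_⟩
    obtain rfl : i = 0 := by omega
    rwa [PowerSeries.coeff_zero_eq_constantCoeff_apply]

end perrinRiou_padicGrossZagier

/-! ### The consequence over `ℚ` in analytic rank one, with the exact constant -/

/-- **Perrin-Riou's `p`-adic Gross–Zagier theorem in its leading-term form over `ℚ` (analytic rank
one): the archimedean and the `p`-adic first derivatives of the `L`-function of `E` are the SAME
rational multiple of the Néron–Tate, resp. canonical cyclotomic `p`-adic, height of one rational
point.** Let `E/ℚ` be an elliptic curve with globally minimal model `W`, `p ≥ 5` a prime of good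
ORDINARY reduction with unit root `α = unitRoot W p`, `D` THE canonical cyclotomic `p`-adic height
datum on `E(ℚ)` (`WeierstrassCurve.PAdicHeightData.IsCanonical`, sigma-function normalisation of
Stein–Wuthrich 2013, (4.1)), and `f` the newform of `E`; suppose `ord_{s=1} L(E,s) = 1`. Then there
are a point `P ∈ E(ℚ)` of infinite order (in the source: the trace to `ℚ` of a Heegner point over an
imaginary quadratic `K` satisfying the Heegner hypothesis, with `p` split in `K` and
`L(E^{(d_K)},1) ≠ 0`) and a rational number `c` (namely `L'(E,1)/(Ω⁺_f·ĥ(P))`, rational by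
Gross–Zagier 1986) such that

  `L'(E,1) = c · Ω⁺_f · ĥ(P)`  and  `[T¹]L_p(f,α,T) · log_p(γ) = c · (1 - α⁻¹)² · ⟨P,P⟩_D`.

Tree normalisations: `L_p(f,α,T) = padicLFunction f α ∈ ℚ_p⟦T⟧` is the Mazur–Swinnerton-Dyer
`p`-adic `L`-function of the `Ω⁺_f`-normalised modular symbols (`constantCoeff_padicLFunction_…`:
`L_p(0) = (1 - α⁻¹)²·L(E,1)/Ω⁺_f`), in the variable `1 + T ↔ γ = cyclotomicGenerator p = 1 + p`,
so that `[T¹]L_p · log_p γ = (d/ds) L_p(γ^s - 1)|_{s=0}` is the derivative at the trivial character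
(independent of `γ`); BOTH sides are normalised by the same period `Ω⁺_f = plusPeriod f` (the
source uses the Néron period `Ω_E` on both sides; `Ω⁺_f/Ω_E ∈ ℚ`, Cremona §2.8, so `c` stays
rational); `ĥ = canonicalHeight` is the Néron–Tate height in the Clay normalisation, `⟨P,P⟩_D` the
canonical `p`-adic height `ĥ_p(P) = 2 log_p(e(P)/σ_p(P))`, `log_p` the Iwasawa logarithm.
Printed forms: Perrin-Riou 1987, Thm. 1.3 with the factorisation (1.1) and its consequence for
`L_p(E/ℚ)` (§1.4, Cor. 1.8): `L_p'(E,1) = (1 - 1/α)² · (L'(E,1)/(Ω_E·ĥ(P))) · ĥ_p(P)` for the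
Heegner point `P`; Stein–Wuthrich 2013, §9 ("If the `L`-series vanishes to the first order",
display before Thm. 9.1; exactly the present normalisations of `L_p`, `ĥ_p`, `γ`): for a generator
`P` of `E(ℚ)/tors` with `ĥ_p(P) ≠ 0`, "a theorem of Perrin-Riou [PR87] asserts the equality of
rational numbers `(1/Reg(E/ℚ))·L'(E,1)/Ω_E = (1/Reg_p(E/ℚ))·(L_p'(E,0)/(1 - 1/α)²)·log(κ(γ))`";
Büyükboduk–Pollack–Sasaki (arXiv:1811.08216), Cor. 1.1.2 with Rem. 1.1.3:
`L'_{p,α}(f_{/ℚ},1) = (1 - 1/α)²·c(f)·h_{α,ℚ}(P_f,P_f)` with `c(f) := -L'(f_{/ℚ},1)/(⟨P_f,P_f⟩_∞ ·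
2πi Ω_f⁺) ∈ K_f^×` (Shimura's period; "`K_f`-rationality of `c(f)` is proved in [GrossZagier1986]";
the `α`-version "follows from Perrin-Riou's `p`-adic Gross–Zagier theorem"). Only the
existence of `(P, c)` is recorded — implied by, never stronger than, the source (which identifies
`P`); `p ≥ 5` (source: `p` odd) because the tree's canonical height is set up for `p ≥ 5`. Nothing
is asserted (named fact, D-0014); users take `(h : perrinRiou_rankOne_leadingTerms)`.
[cite: PerrinRiou1987, Thm. 1.3, (1.1) and §1.4 Cor. 1.8] -/
def perrinRiou_rankOne_leadingTerms : Prop :=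
  ∀ (W : WeierstrassCurve ℚ) [W.IsElliptic] [W.IsGloballyMinimal] (p : ℕ) [Fact p.Prime],
    5 ≤ p → IsOrdinaryAt W p → W.analyticRank = 1 →
    ∀ (D : WeierstrassCurve.PAdicHeightData W p), D.IsCanonical →
    ∀ ⦃N : ℕ⦄ [NeZero N] (f : CuspForm (Gamma0 N) 2), IsNewformOf W f →
    ∃ (P : W.toAffine.Point) (c : ℚ), ¬ IsOfFinAddOrder P ∧
      deriv W.entireLFunction 1 = (((c : ℝ) * plusPeriod f * P.canonicalHeight : ℝ) : ℂ) ∧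
      PowerSeries.coeff 1 (padicLFunction f (unitRoot W p : ℚ_[p])) *
          padicLog p (cyclotomicGenerator p) =
        (c : ℚ_[p]) * (1 - (unitRoot W p : ℚ_[p])⁻¹) ^ 2 * D.pairing P P

end Literature.NumberTheory.EllipticCurves

end
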